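import Summits.QuantumFields.YangMills.Theorems.UnitScaleTiltProp7TJDivRowOfColumns
import Summits.QuantumFields.YangMills.Theorems.UnitScaleTiltProp7TJKernelLocality
import Summits.QuantumFields.YangMills.Theorems.UnitScaleTiltProp7TJDivGaugeDirDict
import HarnessLib

/-!
# N6-J (Tb)∕(TDb) — **THE WEIGHTED VALUE AND DIVERGENCE ROWS OF PRINT's J-TERM `T_Jᴾ(U₀)` FROM THE UNWEIGHTED ROWS, BY TWO-BLOCK LOCALITY**: ★p1 g27's E1∕E2 letters `hTw`∕`hTDw`
# (`Theorems/UnitScaleTiltProp7GreenOneBlockLettersEdition.lean`) at `TJ := TJSlotP F n K h c₀ cB a`, with `CT := k·e^{δ}` (from the sup row of record, constant `k`) and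
# `CTD := 2ρΘ·qG·η²·e^{δ}` (from `hHcol`'s majorant and the gauge-spike row `hqG`, exactly the letters of the unweighted door ✓`Prop7TJDivRowOfColumns`)

Cell `ym3-torus` (HUMAN RULING D-0037, YM ladder rung R3 — SU(2) YM₃ on T³: NOT d = 4, NOT infinite volume, NOT a mass gap, NOT Clay).  Width seat `ym3-torus-px19` (gen 14);
chair ★`ym-ust-19200-p1` g27 CHAIR WORD №37 «GO (TJ-LOC) + (Tb)∕(TDb)-OF-UNWEIGHTED as ONE door».  THEOREMS ONLY (0 `def`, 0 `sorry`, default heartbeats);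
`--supports stmt-QuantumFields-19200 --as helper`; count-neutral.

THE PRINT.  [Balaban1985BackgroundPropagators] (3.127)–(3.128) p.421 (the J-term `−2⟨HC⁽²⁾(A), J⟩` of the reparametrised action), (3.136)–(3.137) pp.422–423 («|(H*J)(b)| ≤ O(1)Mα₀(Lʲη)⁻³»,
«|(Δ⁽²⁾A)(b)| ≤ O(1)Mα₀(Lʲη)⁻²|A| … the supremum |A| is taken over several j-blocks surrounding Δ(y)» — print's own statement that `Δ⁽²⁾ = T_J` is LOCAL), (3.13)–(3.14) pp.392–393,
(3.114)–(3.115) p.418; [Balaban1985Variational] (72) p.289.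

THE MATHEMATICS.  `T_Jᴾ` has NO tail: its kernel `(toL2⁻¹ T_Jᴾ toL2 (δ_b Z))(bd)` vanishes unless the blocks of `b₋` and `bd₋` are adjacent (px12 ✓`Prop7TJKernelLocality.TJP_single_apply_eq_zero_of_far`,
from the two-block read set of `avgHess = D²(log U̿^{twS})(0)`).  Hence for a weighted source `‖Y b‖ ≤ m·e^{−δ·dc(B b₋, z)}`:  (Tb) `(T_Jᴾ Y)(bd) = (T_Jᴾ Y_{bd})(bd)` with
`Y_{bd} := Y·𝟙[dc(B b₋, B bd₋) ≤ 1]`, whose SUP is `≤ m·e^{δ}·e^{−δ·dc(B bd₋, z)}` (triangle inequality), so the unweighted sup row (constant `k`) gives `CT = k·e^{δ}`.  (TDb) the divergence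
entry at `x` is read, exactly as in the unweighted door ✓`norm_DstarL2_TJP_apply_le_of_columns`, through the pairing `⟪T_Jᴾ toL2 Y, D_{U₀} toL2S(δ_x⊗A)⟫ = −(2c₀∕η²)·∇S(H(avgHess Ȳ (gd δ_xA)))`
(✓`inner_TJP_left`); the gauge direction `gd(δ_xA)` lives on the bonds touching `x`, so every coarse bond `ĉ` whose Hessian entry is non-zero has `B x ∈ {ĉ₋, ĉ₊}` and reads `Ȳ` only on
bonds with `dc(B b₋, B x) ≤ 1` (px12 ✓`avgHess_apply_eq_zero_of_vanish_left∕right`): `avgHess Ȳ (gd δ_xA) = avgHess Ȳ_{x} (gd δ_xA)` with `sup‖Y_x‖ ≤ m·e^{δ}·e^{−δ·dc(B x, z)}`, and the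
(J)(H)(qG) column letters finish as before: `CTD = CTD₀·e^{δ}`, `CTD₀ = 2ρΘ·qG·η²` — K-FREE iff `qG` is (no `η⁻¹` from a generic divergence bound).

WHAT IS PROVED (member `F`, `h : n ≤ K`, weights `c₀ cB`, coupling `a`; `RegPr` + the chart windows `10¹²L³ε₀ ≤ 1` of px12's locality, the auxiliary `e`-window discharged inside).
* §1 ★ `norm_localize_le` (the sup of `Y·𝟙[dc(B b₋, w) ≤ 1]` is `≤ m·e^{δ}·e^{−δ·dc(w, z)}`), ★ `TJSlotP_toL2_apply_eq_zero_of_vanish_near` (`(toL2⁻¹ T_Jᴾ toL2 W)(bd) = 0` if `W` vanishes on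
  `dc(B b₋, B bd₋) ≤ 1`), ★ `avgHess_gaugeSpike_eq_of_eqOn_near` (`avgHess X (toL2⁻¹ D_{U₀} toL2S(δ_xA)) = avgHess X′ (…)` if `X = X′` on `dc(B b₋, B x) ≤ 1`).
* §2 ★★★ `hTw_of_supRow` — E2's `hTw` VERBATIM at `TJ := TJSlotP …`, `CT := k·e^{δ}`, from the unweighted sup row `hrow` (✓`tauRow_TJP_of_supRow`'s hypothesis text; ⟸ `hHcol ∧ hC157` by
  ✓`hTJ_of_hHcol_h157`).
* §3 ★★ `norm_DstarL2_TJP_apply_le_of_columns_weighted` — the weighted twin of ✓`norm_DstarL2_TJP_apply_le_of_columns` (letters (J)(H)(qG) VERBATIM).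
* §4 ★★★ `hTDw_of_regPr_column` — E2's `hTDw` VERBATIM at `TJ := TJSlotP …`, `CTD := 2ρΘ·qG·η²·e^{δ}`, from `hHcol`'s majorant (`hcol`, `hsum`) and the gauge-spike row `hQG` — the letters of
  ✓`tjDivRow_of_regPr_column` VERBATIM.
HYP-SAT (★★OWNER RULING №42): `hrow`, `hcol`∕`hsum`, `hQG` are the displayed letters of the unweighted doors (inhabited as there: ✓`hTJ_of_hHcol_h157`, ✓`hHcol_of_kernel133_family`, `hqG` displayed ∕
⟸ ✓`Prop7AvgHessGaugeIdentityNormReading` modulo ⟨(2), FR₂-lite⟩); windows as px12; nothing eventual; no hypothesis restates a conclusion.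
HONEST SCOPE.  Locality bookkeeping over px12's kernel locality and the unweighted doors; nothing of `hHcol`, `hC157`, `hqG`, E1∕E2's knit, `norm_H₁`, EX, the crux or rung R3 is proved
here; the Yang–Mills mass gap is NOT proved.

References: T. Bałaban, CMP **99** (1985) 389–434 [Balaban1985BackgroundPropagators] ((3.127)–(3.128) p.421, (3.136) p.422, (3.137) p.423, (3.13) p.392, (3.14) p.393, (3.114)–(3.115) p.418);
CMP **102** (1985) 277–309 [Balaban1985Variational] ((72) p.289, (28) p.282).
-/

set_option autoImplicit false

noncomputable section

open scoped InnerProductSpace ComplexConjugate Matrix.Norms.L2Operator BigOperators Matrix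

namespace Summit.QuantumFields.YangMills.Theorems.Prop7TJWeightedRowsOfUnweighted

open Literature.MathematicalPhysics.QuantumFieldTheory.Balaban1983to89
open Literature.MathematicalPhysics.QuantumFieldTheory.Balaban1983to89.T3ContinuumYM3Torus
open T3SectALandauChart (eta eta_pos bgUnits)
open T3PrintedRegularMinimiser (RegPr)
open T3PrintedRegularOrbits (sites_eq)
open T3LevelShift (bondShift)
open B5Eq118OneStroke (iterBlockOf)
open B9SectCLatticeCarrier (Bond)
open B11Eq103H1Complex (SiteL2K BondL2K)
open B11Eq90V0primeCurrent (flat115)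
open B3Taylor310LocalRemainder (tdist_comm tdist_self)
open Summit.QuantumFields.YangMills.Theorems.Prop7SectET3Transport (periodsT3)
open Summit.QuantumFields.YangMills.Theorems.Prop7SectET3HilbertLetters (W₂ toL2 toL2S DL2 DstarL2 adjoint_DL2)
open Summit.QuantumFields.YangMills.Theorems.Prop7SectET3CurvedPropagators (H1f)
open Summit.QuantumFields.YangMills.Theorems.Prop7SectET3DeltaPiPInv (DeltaPiSlotP H46P)
open Summit.QuantumFields.YangMills.Theorems.Prop7SectET3DeltaOne (actionGrad avgHess)
open Summit.QuantumFields.YangMills.Theorems.Prop7SectET3DeltaOnePInv (TJP TJSlotP tjFormP_apply tjSesqP_apply inner_TJP_left TJSlotP_apply)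
open Summit.QuantumFields.YangMills.Theorems.Prop7TJRowOfColumns (norm_star_apply_le norm_actionGrad_le_of_regPr sum_norm_H46P_le_of_column)
open Summit.QuantumFields.YangMills.Theorems.Prop7TJDivRowOfColumns (c0_mul_norm_sq_le_norm_sq_toL2S_single inner_toL2S_eq_inner_single_of_apply_eq)
open Summit.QuantumFields.YangMills.Theorems.Prop7TJDivGaugeDirDict (toL2_symm_DL2_toL2S_eq)
open Summit.QuantumFields.YangMills.Theorems.Prop7TJKernelLocality (TJP_single_apply_eq_zero_of_far avgHess_apply_eq_zero_of_vanish_left avgHess_apply_eq_zero_of_vanish_right)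
open Summit.QuantumFields.YangMills.Theorems.Prop7BlockDistanceWeights (tdist_src_tgt_le_one tdist_coarse_comm tdist_coarse_triangle)

variable (F : T3Family) {n K : ℕ} (h : n ≤ K) (c₀ cB a : ℝ)

/-! ## §1 Localisation letters -/

section Letters

/-- ★ **THE LOCALISED WEIGHTED SOURCE IS UNIFORMLY SMALL**: if `‖Y b‖ ≤ m·e^{−δ·dc(B b₋, z)}` for all `b`, then the field `Y·𝟙[dc(B b₋, w) ≤ 1]` has sup `≤ m·e^{δ}·e^{−δ·dc(w, z)}`
(`dc(w, z) ≤ 1 + dc(B b₋, z)` on the support). [folklore] -/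
theorem norm_localize_le {δ : ℝ} (hδ : 0 ≤ δ) (z w : Site (F.P K) (K - n)) (Y : PBond (F.P K) 0 → Matrix (Fin 2) (Fin 2) ℂ) {m : ℝ} (hm : 0 ≤ m)
    (hY : ∀ b, ‖Y b‖ ≤ m * Real.exp (-(δ * (Site.tdist (iterBlockOf (K - n) b.src) z : ℝ)))) (b : PBond (F.P K) 0) :
    ‖(if Site.tdist (iterBlockOf (K - n) b.src) w ≤ 1 then Y b else 0)‖ ≤ m * Real.exp δ * Real.exp (-(δ * (Site.tdist w z : ℝ))) := by
  split_ifs with hnear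
  · refine (hY b).trans ?_
    rw [mul_assoc, ← Real.exp_add]
    refine mul_le_mul_of_nonneg_left (Real.exp_le_exp.2 ?_) hm
    have h1 : (Site.tdist w z : ℝ) ≤ (Site.tdist w (iterBlockOf (K - n) b.src) : ℝ) + (Site.tdist (iterBlockOf (K - n) b.src) z : ℝ) :=
      tdist_coarse_triangle F w _ z
    have h2 : (Site.tdist w (iterBlockOf (K - n) b.src) : ℝ) ≤ 1 := by
      rw [tdist_coarse_comm]; exact_mod_cast hnear
    have h3 : 0 ≤ (Site.tdist (iterBlockOf (K - n) b.src) z : ℝ) := Nat.cast_nonneg _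
    nlinarith
  · rw [norm_zero]; positivity

variable [Fact (0 < c₀)] [Fact (0 < cB)]

/-- ★ **`T_Jᴾ` DOES NOT READ BEYOND THE ADJACENT BLOCKS**: if `W` vanishes on every bond whose source block is within `dc ≤ 1` of the block of `bd₋`, then `(toL2⁻¹ T_Jᴾ(U₀) toL2 W)(bd) = 0`
(bond-spike expansion + px12 ✓`TJP_single_apply_eq_zero_of_far`). [cite: Balaban1985BackgroundPropagators, (3.127)–(3.128) p.421, (3.137) p.423] -/
theorem TJSlotP_toL2_apply_eq_zero_of_vanish_near {ε₀ e : ℝ} (hε₀ : 0 < ε₀) (he : 0 < e) (hWe : 10 ^ 9 * (F.L : ℝ) ^ 2 * e ≤ 1) (hWε : 10 ^ 12 * (F.L : ℝ) ^ 3 * ε₀ ≤ 1)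
    (U₀ : GaugeField (F.P K) 0 (Matrix.specialUnitaryGroup (Fin 2) ℂ)) (hreg : RegPr F n K ε₀ U₀)
    (W : PBond (F.P K) 0 → Matrix (Fin 2) (Fin 2) ℂ) (bd : PBond (F.P K) 0)
    (hW : ∀ b : PBond (F.P K) 0, Site.tdist (iterBlockOf (K - n) b.src) (iterBlockOf (K - n) bd.src) ≤ 1 → W b = 0) :
    (toL2 F K c₀).symm (TJSlotP F n K h c₀ cB a U₀ (toL2 F K c₀ W)) bd = 0 := by
  classical
  have hsum : W = ∑ b : PBond (F.P K) 0, Pi.single b (W b) := (Finset.univ_sum_single W).symm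
  rw [TJSlotP_apply]
  conv_lhs => rw [hsum]
  rw [map_sum, map_sum, map_sum, Finset.sum_apply]
  refine Finset.sum_eq_zero fun b _ => ?_
  by_cases hnear : Site.tdist (iterBlockOf (K - n) b.src) (iterBlockOf (K - n) bd.src) ≤ 1
  · rw [hW b hnear, Pi.single_zero, map_zero, map_zero, map_zero, Pi.zero_apply]
  · exact TJP_single_apply_eq_zero_of_far F h c₀ cB a hε₀ he hWe hWε U₀ hreg b bd (by omega) (W b)

/-- ★ **THE HESSIAN AGAINST A GAUGE SPIKE AT `x` READS ITS FIRST ARGUMENT ONLY NEAR `B x`**: if `X = X′` on every bond whose source block is within `dc ≤ 1` of `B x`, then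
`avgHess U₀ X (toL2⁻¹ D_{U₀} toL2S(δ_x⊗A)) = avgHess U₀ X′ (…)` — a coarse bond whose entry could differ reads a bond touching `x`, hence has `B x ∈ {ĉ₋, ĉ₊}`, and then its whole read set
lies within `dc ≤ 1` of `B x` (px12 ✓`avgHess_apply_eq_zero_of_vanish_left∕right`, ✓`tdist_src_tgt_le_one`). [cite: Balaban1985Variational, (72) p.289; Balaban1985BackgroundPropagators, (3.13) p.392, (3.14) p.393] -/
theorem avgHess_gaugeSpike_eq_of_eqOn_near {ε₀ e : ℝ} (hε₀ : 0 < ε₀) (he : 0 < e) (hWe : 10 ^ 9 * (F.L : ℝ) ^ 2 * e ≤ 1) (hWε : 10 ^ 12 * (F.L : ℝ) ^ 3 * ε₀ ≤ 1)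
    (U₀ : GaugeField (F.P K) 0 (Matrix.specialUnitaryGroup (Fin 2) ℂ)) (hreg : RegPr F n K ε₀ U₀)
    (X X' : PBond (F.P K) 0 → Matrix (Fin 2) (Fin 2) ℂ) (x : Site (F.P K) 0) (A : Matrix (Fin 2) (Fin 2) ℂ)
    (hXX' : ∀ b : PBond (F.P K) 0, Site.tdist (iterBlockOf (K - n) b.src) (iterBlockOf (K - n) x) ≤ 1 → X b = X' b) (c : PBond (F.P n) 0) :
    avgHess F n K h U₀ X ((toL2 F K c₀).symm (DL2 F n K c₀ U₀ (toL2S F K c₀ (Pi.single x A)))) c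
      = avgHess F n K h U₀ X' ((toL2 F K c₀).symm (DL2 F n K c₀ U₀ (toL2S F K c₀ (Pi.single x A)))) c := by
  classical
  set V : PBond (F.P K) 0 → Matrix (Fin 2) (Fin 2) ℂ := (toL2 F K c₀).symm (DL2 F n K c₀ U₀ (toL2S F K c₀ (Pi.single x A))) with hVdef
  set s₀ : Site (F.P K) (K - n) := (bondShift (sites_eq F n K h) c).src with hs₀
  set t₀ : Site (F.P K) (K - n) := (bondShift (sites_eq F n K h) c).tgt with ht₀
  -- the difference is the Hessian of `X − X′`
  have hlin : avgHess F n K h U₀ X V c - avgHess F n K h U₀ X' V c = avgHess F n K h U₀ (X - X') V c := by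
    rw [map_sub, sub_apply, Pi.sub_apply]
  rw [← sub_eq_zero, hlin]
  by_cases hfar : ∀ b : PBond (F.P K) 0,
      (iterBlockOf (K - n) b.src = s₀ ∨ iterBlockOf (K - n) b.src = t₀) → (iterBlockOf (K - n) b.tgt = s₀ ∨ iterBlockOf (K - n) b.tgt = t₀) → V b = 0
  · -- the gauge spike is not read by `c`
    exact avgHess_apply_eq_zero_of_vanish_right F h hε₀ he hWe hWε U₀ hreg (X - X') V c (by rw [hs₀, ht₀] at hfar; exact hfar)
  · -- some read bond `b₀` carries the spike, hence touches `x`: `B x ∈ {ĉ₋, ĉ₊}`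
    push Not at hfar
    obtain ⟨b₀, hb₀s, hb₀t, hVb₀⟩ := hfar
    have hV : V = -(((eta F n K : ℝ) : ℂ)⁻¹) • (fun b : PBond (F.P K) 0 =>
        (Pi.single x A : Site (F.P K) 0 → Matrix (Fin 2) (Fin 2) ℂ) b.src
          - ((bgUnits F K U₀ b : (Matrix (Fin 2) (Fin 2) ℂ)ˣ) : Matrix (Fin 2) (Fin 2) ℂ) * (Pi.single x A : Site (F.P K) 0 → Matrix (Fin 2) (Fin 2) ℂ) b.tgt
            * (((bgUnits F K U₀ b)⁻¹ : (Matrix (Fin 2) (Fin 2) ℂ)ˣ) : Matrix (Fin 2) (Fin 2) ℂ)) := by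
      rw [hVdef]; exact toL2_symm_DL2_toL2S_eq U₀ (Pi.single x A)
    have hx : iterBlockOf (K - n) x = s₀ ∨ iterBlockOf (K - n) x = t₀ := by
      by_contra hxn
      push Not at hxn
      apply hVb₀
      have hsrc : (Pi.single x A : Site (F.P K) 0 → Matrix (Fin 2) (Fin 2) ℂ) b₀.src = 0 := by
        rw [Pi.single_eq_of_ne]
        rintro heq
        rw [heq] at hb₀s
        rcases hb₀s with h1 | h1 <;> [exact hxn.1 h1; exact hxn.2 h1]
      have htgt : (Pi.single x A : Site (F.P K) 0 → Matrix (Fin 2) (Fin 2) ℂ) b₀.tgt = 0 := by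
        rw [Pi.single_eq_of_ne]
        rintro heq
        rw [heq] at hb₀t
        rcases hb₀t with h1 | h1 <;> [exact hxn.1 h1; exact hxn.2 h1]
      rw [hV, Pi.smul_apply, hsrc, htgt, Matrix.mul_zero, Matrix.zero_mul, sub_zero, smul_zero]
    -- every bond read by `c` has its source block within `dc ≤ 1` of `B x`, where `X = X′`
    refine avgHess_apply_eq_zero_of_vanish_left F h hε₀ he hWe hWε U₀ hreg (X - X') V c fun b hbs _ => ?_
    rw [hs₀, ht₀] at hx
    have hst : Site.tdist (bondShift (sites_eq F n K h) c).src (bondShift (sites_eq F n K h) c).tgt ≤ 1 := tdist_src_tgt_le_one _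
    have hnear : Site.tdist (iterBlockOf (K - n) b.src) (iterBlockOf (K - n) x) ≤ 1 := by
      rcases hbs with h1 | h1 <;> rcases hx with h2 | h2 <;> rw [h1, h2]
      · rw [tdist_self]; exact Nat.zero_le _
      · exact hst
      · rw [tdist_comm]; exact hst
      · rw [tdist_self]; exact Nat.zero_le _
    rw [Pi.sub_apply, hXX' b hnear, sub_self]

end Letters

/-! ## §2 (Tb): the weighted value row of `T_Jᴾ` from the sup row of record -/

section Value

variable [Fact (0 < c₀)] [Fact (0 < cB)]

/-- ★★★ **E2's LETTER `hTw` AT `TJ := TJSlotP`, `CT := k·e^{δ}`, FROM THE UNWEIGHTED SUP ROW**: `RegPr F n K ε₀ U₀`, `10¹²L³ε₀ ≤ 1`, the sup row of record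
`hrow : ∀ X s, (∀ bd, ‖X bd‖ ≤ s) → ∀ bd, ‖toL2⁻¹(T_Jᴾ(U₀)(toL2 X))(bd)‖ ≤ k·s` (✓`tauRow_TJP_of_supRow`'s hypothesis; ⟸ `hHcol ∧ hC157`) and `0 ≤ δ` ⟹ for every block `z`, every `m ≥ 0` and
every `Y` with `‖Y b‖ ≤ m·e^{−δ·dc(B b₋, z)}`: `‖toL2⁻¹(T_Jᴾ(U₀)(toL2 Y))(bd)‖ ≤ (k·e^{δ})·m·e^{−δ·dc(B bd₋, z)}` — `T_Jᴾ` reads `Y` only within `dc ≤ 1` (§1).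
[cite: Balaban1985BackgroundPropagators, (3.127)–(3.128) p.421, (3.137) p.423] -/
theorem hTw_of_supRow {ε₀ : ℝ} (hε₀ : 0 < ε₀) (hWε : 10 ^ 12 * (F.L : ℝ) ^ 3 * ε₀ ≤ 1)
    (U₀ : GaugeField (F.P K) 0 (Matrix.specialUnitaryGroup (Fin 2) ℂ)) (hreg : RegPr F n K ε₀ U₀) {k : ℝ}
    (hrow : ∀ (X : PBond (F.P K) 0 → Matrix (Fin 2) (Fin 2) ℂ) (s : ℝ), (∀ bd, ‖X bd‖ ≤ s) →
      ∀ bd : PBond (F.P K) 0, ‖(toL2 F K c₀).symm (TJSlotP F n K h c₀ cB a U₀ (toL2 F K c₀ X)) bd‖ ≤ k * s)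
    {δ : ℝ} (hδ : 0 ≤ δ) :
    ∀ (z : Site (F.P K) (K - n)) (Y : PBond (F.P K) 0 → Matrix (Fin 2) (Fin 2) ℂ) (m : ℝ), 0 ≤ m →
      (∀ b, ‖Y b‖ ≤ m * Real.exp (-(δ * (Site.tdist (iterBlockOf (K - n) b.src) z : ℝ)))) →
      ∀ bd, ‖(toL2 F K c₀).symm (TJSlotP F n K h c₀ cB a U₀ (toL2 F K c₀ Y)) bd‖ ≤ (k * Real.exp δ) * m * Real.exp (-(δ * (Site.tdist (iterBlockOf (K - n) bd.src) z : ℝ))) := by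
  intro z Y m hm hY bd
  classical
  -- the auxiliary chart window of px12's locality
  have hL1 : (1 : ℝ) ≤ F.L := by have := F.hL.2; exact_mod_cast (by omega : 1 ≤ F.L)
  set e : ℝ := (10 ^ 9 * (F.L : ℝ) ^ 2)⁻¹ with he_def
  have he : 0 < e := by rw [he_def]; positivity
  have hWe : 10 ^ 9 * (F.L : ℝ) ^ 2 * e ≤ 1 := by rw [he_def, mul_inv_cancel₀ (by positivity)]
  -- localise `Y` at `B bd₋`
  set Yn : PBond (F.P K) 0 → Matrix (Fin 2) (Fin 2) ℂ := fun b =>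
    if Site.tdist (iterBlockOf (K - n) b.src) (iterBlockOf (K - n) bd.src) ≤ 1 then Y b else 0 with hYn
  have hfar : (toL2 F K c₀).symm (TJSlotP F n K h c₀ cB a U₀ (toL2 F K c₀ (Y - Yn))) bd = 0 :=
    TJSlotP_toL2_apply_eq_zero_of_vanish_near F h c₀ cB a hε₀ he hWe hWε U₀ hreg (Y - Yn) bd fun b hb => by
      rw [Pi.sub_apply, hYn]; simp only [if_pos hb, sub_self]
  have hsplit : (toL2 F K c₀).symm (TJSlotP F n K h c₀ cB a U₀ (toL2 F K c₀ Y)) bd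
      = (toL2 F K c₀).symm (TJSlotP F n K h c₀ cB a U₀ (toL2 F K c₀ Yn)) bd := by
    have hY' : Y = Yn + (Y - Yn) := by abel
    conv_lhs => rw [hY']
    rw [map_add, map_add, map_add, Pi.add_apply, hfar, add_zero]
  rw [hsplit]
  have hYn_le : ∀ b, ‖Yn b‖ ≤ m * Real.exp δ * Real.exp (-(δ * (Site.tdist (iterBlockOf (K - n) bd.src) z : ℝ))) :=
    fun b => norm_localize_le F (K := K) (n := n) hδ z (iterBlockOf (K - n) bd.src) Y hm hY b
  calc ‖(toL2 F K c₀).symm (TJSlotP F n K h c₀ cB a U₀ (toL2 F K c₀ Yn)) bd‖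
      ≤ k * (m * Real.exp δ * Real.exp (-(δ * (Site.tdist (iterBlockOf (K - n) bd.src) z : ℝ)))) := hrow Yn _ hYn_le bd
    _ = (k * Real.exp δ) * m * Real.exp (-(δ * (Site.tdist (iterBlockOf (K - n) bd.src) z : ℝ))) := by ring

end Value

/-! ## §3 (TDb): the weighted divergence row of `T_Jᴾ` from the column letters (J)(H)(qG) -/

section Divergence

variable {F} {h} {c₀ cB a} [Fact (0 < c₀)] [Fact (0 < cB)]

/-- ★★ **THE WEIGHTED TWIN OF ✓`norm_DstarL2_TJP_apply_le_of_columns`**: the same three column letters (J) `‖actionGrad U₀ Z‖ ≤ cJ·Σ_b‖Z b‖`, (H) `Σ_b‖H46P U₀ B b‖ ≤ θ·Σ_y‖B y‖`,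
(qG) the gauge-spike Hessian row, now for a WEIGHTED source `‖Y b‖ ≤ m·e^{−δ·dc(B b₋, z)}` at a printed-regular background (px12's locality windows):
`‖(toL2S⁻¹(D*_{U₀}(T_Jᴾ(toL2 Y))))(x)‖ ≤ (2∕η²)·cJ·θ·qG·(m·e^{δ}·e^{−δ·dc(B x, z)})` — the pairing with the pure-gauge spike at `x` reads `Ȳ` only within `dc ≤ 1` of `B x` (§1).
[cite: Balaban1985BackgroundPropagators, (3.127)–(3.128) p.421, (3.137) p.423, (3.11) p.392, (3.114)–(3.115) p.418] -/
theorem norm_DstarL2_TJP_apply_le_of_columns_weighted {ε₀ e : ℝ} (hε₀ : 0 < ε₀) (he : 0 < e) (hWe : 10 ^ 9 * (F.L : ℝ) ^ 2 * e ≤ 1) (hWε : 10 ^ 12 * (F.L : ℝ) ^ 3 * ε₀ ≤ 1)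
    (U₀ : GaugeField (F.P K) 0 (Matrix.specialUnitaryGroup (Fin 2) ℂ)) (hreg : RegPr F n K ε₀ U₀) {cJ θ qG : ℝ} (hcJ : 0 ≤ cJ) (hθ : 0 ≤ θ) (hqG : 0 ≤ qG)
    (hJ : ∀ Z : PBond (F.P K) 0 → Matrix (Fin 2) (Fin 2) ℂ, ‖actionGrad F K U₀ Z‖ ≤ cJ * ∑ b : PBond (F.P K) 0, ‖Z b‖)
    (hH : ∀ B : PBond (F.P n) 0 → Matrix (Fin 2) (Fin 2) ℂ, ∑ bd : PBond (F.P K) 0, ‖H46P F n K h c₀ cB a U₀ B bd‖ ≤ θ * ∑ y : PBond (F.P n) 0, ‖B y‖)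
    (hQG : ∀ (X' : PBond (F.P K) 0 → Matrix (Fin 2) (Fin 2) ℂ) (s' : ℝ) (x : Site (F.P K) 0) (A : Matrix (Fin 2) (Fin 2) ℂ), (∀ b, ‖X' b‖ ≤ s') →
      ∑ y : PBond (F.P n) 0, ‖avgHess F n K h U₀ X' ((toL2 F K c₀).symm (DL2 F n K c₀ U₀ (toL2S F K c₀ (Pi.single x A)))) y‖ ≤ qG * s' * ‖A‖)
    {δ : ℝ} (hδ : 0 ≤ δ) (z : Site (F.P K) (K - n)) (Y : PBond (F.P K) 0 → Matrix (Fin 2) (Fin 2) ℂ) {m : ℝ} (hm : 0 ≤ m)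
    (hY : ∀ b, ‖Y b‖ ≤ m * Real.exp (-(δ * (Site.tdist (iterBlockOf (K - n) b.src) z : ℝ)))) (x : Site (F.P K) 0) :
    ‖(toL2S F K c₀).symm (DstarL2 F n K c₀ U₀ (TJP F n K h c₀ cB a U₀ (toL2 F K c₀ Y))) x‖
      ≤ 2 / (eta F n K) ^ 2 * cJ * θ * qG * (m * Real.exp δ * Real.exp (-(δ * (Site.tdist (iterBlockOf (K - n) x) z : ℝ)))) := by
  classical
  have hc₀ : (0 : ℝ) < c₀ := Fact.out
  have hη : 0 < eta F n K := eta_pos F n K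
  set s : ℝ := m * Real.exp δ * Real.exp (-(δ * (Site.tdist (iterBlockOf (K - n) x) z : ℝ))) with hsdef
  have hs : 0 ≤ s := by positivity
  set v : SiteL2K ℂ 3 (periodsT3 F K) c₀ W₂ := DstarL2 F n K c₀ U₀ (TJP F n K h c₀ cB a U₀ (toL2 F K c₀ Y)) with hvdef
  set g : Site (F.P K) 0 → Matrix (Fin 2) (Fin 2) ℂ := (toL2S F K c₀).symm v with hgdef
  set A : Matrix (Fin 2) (Fin 2) ℂ := g x with hAdef
  set w : SiteL2K ℂ 3 (periodsT3 F K) c₀ W₂ := toL2S F K c₀ (Pi.single x A) with hwdef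
  -- (1) `⟪v, w⟫ = ⟪w, w⟫`
  have hvg : v = toL2S F K c₀ g := by rw [hgdef, LinearEquiv.apply_symm_apply]
  have h1 : ⟪v, w⟫_ℂ = ⟪w, w⟫_ℂ := by
    rw [hvg, hwdef, hAdef]
    exact inner_toL2S_eq_inner_single_of_apply_eq g x
  -- (2) move `D*` across and read `D w` on the route carrier
  set X' : PBond (F.P K) 0 → Matrix (Fin 2) (Fin 2) ℂ := (toL2 F K c₀).symm (DL2 F n K c₀ U₀ w) with hX'def
  have hDw : DL2 F n K c₀ U₀ w = toL2 F K c₀ X' := by rw [hX'def, LinearEquiv.apply_symm_apply]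
  have h2 : ⟪v, w⟫_ℂ = ⟪TJP F n K h c₀ cB a U₀ (toL2 F K c₀ Y), toL2 F K c₀ X'⟫_ℂ := by
    rw [hvdef, ← adjoint_DL2, LinearMap.adjoint_inner_left, hDw]
  -- (3) the pairing through the J-term formula
  have h3 : ⟪v, w⟫_ℂ = ((-(2 * (c₀ : ℂ))) / (((eta F n K : ℝ) : ℂ)) ^ 2) *
      -actionGrad F K U₀ (H46P F n K h c₀ cB a U₀ (avgHess F n K h U₀ (star Y) X')) := by
    rw [h2, inner_TJP_left, tjSesqP_apply, tjFormP_apply, LinearEquiv.symm_apply_apply, LinearEquiv.symm_apply_apply]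
  -- (3′) LOCALISATION: the Hessian against the gauge spike at `x` reads `Ȳ` only within `dc ≤ 1` of `B x`
  set Yn : PBond (F.P K) 0 → Matrix (Fin 2) (Fin 2) ℂ := fun b =>
    if Site.tdist (iterBlockOf (K - n) b.src) (iterBlockOf (K - n) x) ≤ 1 then Y b else 0 with hYn
  have hYn_le : ∀ b, ‖Yn b‖ ≤ s := fun b => norm_localize_le F (K := K) (n := n) hδ z (iterBlockOf (K - n) x) Y hm hY b
  have hXs : ∀ b, ‖(star Yn) b‖ ≤ s := norm_star_apply_le hYn_le
  have hloc : avgHess F n K h U₀ (star Y) X' = avgHess F n K h U₀ (star Yn) X' := by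
    funext c
    rw [hX'def, hwdef]
    exact avgHess_gaugeSpike_eq_of_eqOn_near F h c₀ hε₀ he hWe hWε U₀ hreg (star Y) (star Yn) x A (fun b hb => by
      rw [Pi.star_apply, Pi.star_apply, hYn]; simp only [if_pos hb]) c
  -- (4) the upper bound of the pairing from (J)(H)(qG)
  have h4 : ‖⟪v, w⟫_ℂ‖ ≤ 2 * c₀ / (eta F n K) ^ 2 * (cJ * (θ * (qG * s * ‖A‖))) := by
    rw [h3, norm_mul, norm_neg]
    have hcoef : ‖(-(2 * (c₀ : ℂ))) / (((eta F n K : ℝ) : ℂ)) ^ 2‖ = 2 * c₀ / (eta F n K) ^ 2 := by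
      rw [norm_div, norm_neg, norm_mul, norm_pow, Complex.norm_real, Complex.norm_real, Real.norm_of_nonneg hc₀.le, Real.norm_of_nonneg hη.le, Complex.norm_ofNat]
    rw [hcoef]
    refine mul_le_mul_of_nonneg_left ?_ (by positivity)
    calc ‖actionGrad F K U₀ (H46P F n K h c₀ cB a U₀ (avgHess F n K h U₀ (star Y) X'))‖
        ≤ cJ * ∑ b : PBond (F.P K) 0, ‖H46P F n K h c₀ cB a U₀ (avgHess F n K h U₀ (star Y) X') b‖ := hJ _
      _ ≤ cJ * (θ * ∑ y : PBond (F.P n) 0, ‖avgHess F n K h U₀ (star Y) X' y‖) := mul_le_mul_of_nonneg_left (hH _) hcJ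
      _ ≤ cJ * (θ * (qG * s * ‖A‖)) := by
          refine mul_le_mul_of_nonneg_left (mul_le_mul_of_nonneg_left ?_ hθ) hcJ
          have hq := hQG (star Yn) s x A hXs
          rw [← hwdef, ← hX'def, ← hloc] at hq
          exact hq
  -- (5) the lower bound `c₀‖A‖² ≤ ‖w‖² = ‖⟪v, w⟫‖`
  have h5 : c₀ * ‖A‖ ^ 2 ≤ ‖w‖ ^ 2 := by rw [hwdef]; exact c0_mul_norm_sq_le_norm_sq_toL2S_single x A
  have h6 : ‖⟪v, w⟫_ℂ‖ = ‖w‖ ^ 2 := by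
    rw [h1, inner_self_eq_norm_sq_to_K, norm_pow, RCLike.norm_ofReal, abs_norm]
  have h7 : c₀ * ‖A‖ ^ 2 ≤ 2 * c₀ / (eta F n K) ^ 2 * (cJ * (θ * (qG * s * ‖A‖))) := h5.trans (h6 ▸ h4)
  -- (6) divide by `c₀‖A‖`
  have hK : 0 ≤ 2 / (eta F n K) ^ 2 * cJ * θ * qG * s := by positivity
  show ‖A‖ ≤ 2 / (eta F n K) ^ 2 * cJ * θ * qG * s
  by_cases hA0 : ‖A‖ = 0
  · rw [hA0]; exact hK
  · have hApos : 0 < ‖A‖ := lt_of_le_of_ne (norm_nonneg _) (Ne.symm hA0)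
    have h8 : ‖A‖ * (c₀ * ‖A‖) ≤ (2 / (eta F n K) ^ 2 * cJ * θ * qG * s) * (c₀ * ‖A‖) := by
      calc ‖A‖ * (c₀ * ‖A‖) = c₀ * ‖A‖ ^ 2 := by ring
        _ ≤ 2 * c₀ / (eta F n K) ^ 2 * (cJ * (θ * (qG * s * ‖A‖))) := h7
        _ = (2 / (eta F n K) ^ 2 * cJ * θ * qG * s) * (c₀ * ‖A‖) := by ring
    exact le_of_mul_le_mul_right h8 (by positivity)

/-- ★★★ **E2's LETTER `hTDw` AT `TJ := TJSlotP`, `CTD := 2ρΘ·qG·η²·e^{δ}`, FROM `hHcol`'s MAJORANT AND THE GAUGE-SPIKE ROW** — the weighted twin of ✓`tjDivRow_of_regPr_column`, with the SAME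
letters: `U₀ ∈ 𝔘_k(ρ)` (`10¹²L³ρ ≤ 1`), an `hHcol`-shaped column majorant (`hcol`, `hsum` with total `Θ`) and the gauge-spike Hessian row (qG); THEN for every block `z`, `m ≥ 0`, and weighted
source `‖Y b‖ ≤ m·e^{−δ·dc(B b₋, z)}`: `‖(toL2S⁻¹(D*_{U₀}(T_Jᴾ(toL2 Y))))(x)‖ ≤ (2ρΘ·qG·η²·e^{δ})·m·e^{−δ·dc(B x, z)}` — (J) by ✓`norm_actionGrad_le_of_regPr` (`cJ := η³ρ`), (H) by
✓`sum_norm_H46P_le_of_column` (`θ := η·Θ`), the auxiliary chart window of px12's locality discharged at `e := (10⁹L²)⁻¹`.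
[cite: Balaban1985BackgroundPropagators, (3.127)–(3.128) p.421, (3.137) p.423, (3.126) p.420, (3.114)–(3.115) p.418; Balaban1985Variational, (28) p.282] -/
theorem hTDw_of_regPr_column [Fact (0 < (F.L : ℝ))] [Fact (0 < ((F.L : ℝ)⁻¹) ^ (K - n))] {ρ Θ qG : ℝ} (hρ : 0 < ρ) (hWρ : 10 ^ 12 * (F.L : ℝ) ^ 3 * ρ ≤ 1) (hΘ : 0 ≤ Θ) (hqG : 0 ≤ qG)
    (U₀ : GaugeField (F.P K) 0 (Matrix.specialUnitaryGroup (Fin 2) ℂ)) (hreg : RegPr F n K ρ U₀)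
    {hk : Bond 3 (periodsT3 F K) → PBond (F.P n) 0 → ℝ}
    (hcol : ∀ (y : PBond (F.P n) 0) (Z : Matrix (Fin 2) (Fin 2) ℂ) (b' : Bond 3 (periodsT3 F K)),
      ‖flat115 (H1f F n K h c₀ cB a (DeltaPiSlotP F n K h c₀ cB a) U₀ (Pi.single y Z)) b'‖ ≤ hk b' y * ‖Z‖)
    (hsum : ∀ y : PBond (F.P n) 0, ∑ b' : Bond 3 (periodsT3 F K), hk b' y ≤ Θ)
    (hQG : ∀ (X' : PBond (F.P K) 0 → Matrix (Fin 2) (Fin 2) ℂ) (s' : ℝ) (x : Site (F.P K) 0) (A : Matrix (Fin 2) (Fin 2) ℂ), (∀ b, ‖X' b‖ ≤ s') →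
      ∑ y : PBond (F.P n) 0, ‖avgHess F n K h U₀ X' ((toL2 F K c₀).symm (DL2 F n K c₀ U₀ (toL2S F K c₀ (Pi.single x A)))) y‖ ≤ qG * s' * ‖A‖)
    {δ : ℝ} (hδ : 0 ≤ δ) :
    ∀ (z : Site (F.P K) (K - n)) (Y : PBond (F.P K) 0 → Matrix (Fin 2) (Fin 2) ℂ) (m : ℝ), 0 ≤ m →
      (∀ b, ‖Y b‖ ≤ m * Real.exp (-(δ * (Site.tdist (iterBlockOf (K - n) b.src) z : ℝ)))) →
      ∀ x, ‖(toL2S F K c₀).symm (DstarL2 F n K c₀ U₀ (TJSlotP F n K h c₀ cB a U₀ (toL2 F K c₀ Y))) x‖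
        ≤ (2 * ρ * Θ * qG * (eta F n K) ^ 2 * Real.exp δ) * m * Real.exp (-(δ * (Site.tdist (iterBlockOf (K - n) x) z : ℝ))) := by
  intro z Y m hm hY x
  -- the auxiliary chart window of px12's locality
  set e : ℝ := (10 ^ 9 * (F.L : ℝ) ^ 2)⁻¹ with he_def
  have hL0 : (0 : ℝ) < F.L := Fact.out
  have he : 0 < e := by rw [he_def]; positivity
  have hWe : 10 ^ 9 * (F.L : ℝ) ^ 2 * e ≤ 1 := by rw [he_def, mul_inv_cancel₀ (by positivity)]
  have hJ := norm_actionGrad_le_of_regPr (F := F) (n := n) (K := K) hρ.le U₀ hreg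
  have hH := sum_norm_H46P_le_of_column (h := h) (c₀ := c₀) (cB := cB) (a := a) U₀ hcol hsum
  have hmain := norm_DstarL2_TJP_apply_le_of_columns_weighted (h := h) (c₀ := c₀) (cB := cB) (a := a) hρ he hWe hWρ U₀ hreg
    (cJ := (((F.L : ℝ)⁻¹) ^ (K - n)) ^ 3 * ρ) (θ := eta F n K * Θ) (mul_nonneg (by positivity) hρ.le) (mul_nonneg (eta_pos F n K).le hΘ) hqG hJ hH hQG hδ z Y hm hY x
  rw [TJSlotP_apply]
  calc ‖(toL2S F K c₀).symm (DstarL2 F n K c₀ U₀ (TJP F n K h c₀ cB a U₀ (toL2 F K c₀ Y))) x‖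
      ≤ 2 / (eta F n K) ^ 2 * ((((F.L : ℝ)⁻¹) ^ (K - n)) ^ 3 * ρ) * (eta F n K * Θ) * qG
          * (m * Real.exp δ * Real.exp (-(δ * (Site.tdist (iterBlockOf (K - n) x) z : ℝ)))) := hmain
    _ = (2 * ρ * Θ * qG * (eta F n K) ^ 2 * Real.exp δ) * m * Real.exp (-(δ * (Site.tdist (iterBlockOf (K - n) x) z : ℝ))) := by
        have hdef : eta F n K = ((F.L : ℝ)⁻¹) ^ (K - n) := rfl
        rw [← hdef]
        have hη : 0 < eta F n K := eta_pos F n K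
        field_simp

end Divergence

end Summit.QuantumFields.YangMills.Theorems.Prop7TJWeightedRowsOfUnweighted

end
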